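import Summits.HodgeConjecture.HodgeConjecture.Theorems.F0P6aChartFramePin                      -- ★ RE-HOMED frame pin `IsChartOfFrame` (+ ★ p850070 E-LINE DEFINITIONS LAYER `AuxChartGS`, `GSAdele`; namespaces kept)
import Literature.AlgebraicGeometry.ShimuraVarieties.UnitaryCurveSiegelPointMapTwisted            -- ★ p850526 (LA4-p01 (g3), DEAL #37a): `UnitaryCurve.exists_pointMap_of_shadow_mul` (the twisted class map `[J v, b a·u]`)
import Literature.AlgebraicGeometry.ShimuraVarieties.UnitaryCurveSiegelShadowContinuous          -- ★ (LA4-p01 (g3), DEAL #35): `UnitaryCurve.continuous_of_pts_shadow` ∕ `…_of_bce_pts_shadow` ∕ `continuous_mk_left_of_pts_shadow`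
import Literature.AlgebraicGeometry.Motives.FiniteCoproductVarieties                             -- ★ `Motives.exists_sigmaHomeomorph_of_isColimit_cofan` (complex points of the piece cofan)
import HarnessLib

/-!
# «DEAL #35 — `f₂` CONTINUOUS» AT THE CHART `C : AuxChartGS …` — ★ Theorems twin of the HOME Lines bytes `F0/P6/L4/LA4-p01/g3/AuxChartShadowContinuous.v1.LA4-p01g3.lean`
# («L4» LA4-p01 (g3), for LA4-p02 (g2) (β1) ★ p850424 ∕ LA7-p01 (g3) LEG-E of the `stub_SHEET` closer, road B′; crux hLiu418 = stmt-HodgeConjecture-24832, `--supports`,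
# count-neutral; imports ONLY the ★ re-homed definitions layer `Theorems.F0P6aPELWitnessEDefs` (p850070, namespace kept) + ★ Literature — NO `Lines/` import, so it
# serves the RE-HOMED chain; a Lines closer that still imports the `Lines/` definitions layer pastes the identical HOME bytes instead and the re-homer swaps to this import)

★ `UnitaryCurve.continuous_of_pts_shadow` (generic chart currency) instantiated at the fields of an auxiliary Siegel chart `C : AuxChartGS F ι₁ J⋆ K₀ S Kc Fᵢ τE Φ`:
* §1 `AuxChartGS.exists_rep_of_siegelShimuraSet` — the COVER «every Siegel class at level `K_δ(N)` is `[jOfSiegel W, C.rep c]`» from `C.isColimit_ιc`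
  (★ `Motives.exists_sigmaHomeomorph_of_isColimit_cofan`: the complex points of `𝓜.M ⊗ ℂ` are those of the pieces), `C.unif_surj`, `C.pts` (a bijection), `C.pts_unif`;
* §2 **`AuxChartGS.continuous_mk_left_of_pts_shadow`** (per adelic `a`: `v ↦ G [v, aKc]` continuous on the cone — THE SHAPE ★ p850424
  `ShimuraSetGS.eq_of_forall_mk_eq_of_forall_continuous_mk` consumes), **`AuxChartGS.continuous_of_pts_shadow`** (`Continuous G` on `Sh_{Kc}(ℂ)`): for ANY
  `x : U(J⋆)(𝔸_f) → GSp_δ(𝔸_f)` and ANY `G : Sh_{Kc}(ℂ) → (𝓜.M ⊗ ℂ)(ℂ)` with `C.pts (G [v, aKc]) = [C.J v, x a]`; and the `ℚ`-points currency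
  `AuxChartGS.continuous_of_bce_pts_shadow` (`G : Sh_{Kc}(ℂ) → 𝓜.M(ℂ)`, shadow through `AlgPoints.baseChangeEquiv (ℚ → ℂ) 𝓜.M` as in `C.f_pts`);
* §3 the corollaries for the chart՚s OWN point map: `AuxChartGS.continuous_f_mk_left`, **`AuxChartGS.continuous_f : Continuous C.f`** (`x := C.b`, shadow `C.f_pts`)
  — the named export «`f` continuous» that the E-line never stated (A-p01 (g28) 08:01:35Z);
* §4 (ED. 2, add-only) **`AuxChartGS.exists_fTwo`** (DEAL #37a-CHART): under the frame pin `IsChartOfFrame` (★ `Theorems.F0P6aChartFramePin`), for every torus idèle `t`, a point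
  map `f₂ : Sh_{Kc}(ℂ) → 𝓜.M(ℂ)` with shadow `C.pts (bce (f₂ [v, aKc])) = [C.J v, C.b a · ũ_V(1, t)]`, continuous, and continuous in the cone variable on every piece
  (`AuxChartGS.b_mul_torusLeg_comm`) — the `(f₂, hf₂, hf₂c)` binders of ★ p850504 ∕ ★ p850527 (the twisted-sheet point law) and of ★ p849999 (the forward law).
THEOREMS ONLY (no definition, no `sorry`).  USE (road B′, (β)): `f₂ [v, aKc] := C.pts⁻¹ [C.J v, C.b a · ũ_V(1, z)]` — take `x a := C.b a * ũ`, `G := f₂`, `hG` = its defining shadow law; then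
`AuxChartGS.continuous_mk_left_of_pts_shadow C x f₂ hG` is the `hg` of ★ `eq_of_forall_mk_eq_of_forall_continuous_mk` ∕ `RecordSystemGS.map_eq_of_heckeOrbit_of_continuous_mk*`.
HC_CM is proved only modulo the 7 printed citations (2 remaining: hLiu418 = stmt-HodgeConjecture-24832, h413 = stmt-HodgeConjecture-24833) until rung 0 closes.
-/

set_option autoImplicit false

noncomputable section

namespace Summit.HodgeConjecture.HodgeConjecture.Cruxes.HLiu418.F0P6aPELWitnessE

set_option linter.dupNamespace false

open CategoryTheory CategoryTheory.Limits NumberField IsDedekindDomain MulAction Matrix AlgebraicGeometry Topology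
open scoped Matrix ComplexOrder
open Literature.AlgebraicGeometry.Motives (SchemeOver AlgPoints ComplexPoints specOver)
open Literature.AlgebraicGeometry.ModuliOfAbelianVarieties
open Literature.AlgebraicGeometry.ModuliOfAbelianVarieties.SiegelModuli (C0 jOfSiegel jOfSiegel_mem_C0)
open Literature.AlgebraicGeometry.ShimuraVarieties Literature.AlgebraicGeometry.ShimuraVarieties.UnitaryCanonicalModel
open Literature.NumberTheory.Automorphic Literature.NumberTheory.Automorphic.UnitaryGroup
open Literature.NumberTheory.Automorphic.Liu2021.AppendixC (C5.OpenCompactSubgroup C5.SmallLevel)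

variable {F : Type} [Field F] [NumberField F] [IsCMField F] {ι₁ : F →+* ℂ} {Jstar : Matrix (Fin 2) (Fin 2) F}
  {K₀ : C5.OpenCompactSubgroup (GSAdele F Jstar)} {S : RecordSystemGS F Jstar ι₁ K₀} {Kc : C5.SmallLevel K₀}
  {Fi : Type} [Field Fi] [NumberField Fi] [Algebra F Fi] {τE : Fi →+* ℂ} {Φ : Set (F →+* ℂ)}
  (C : AuxChartGS F ι₁ Jstar K₀ S Kc Fi τE Φ)

/-! ### §1 The cover: every Siegel class at level `K_δ(N)` is `[jOfSiegel W, C.rep c]` -/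

/-- **EVERY SIEGEL CLASS IS A CHART CLASS `[jOfSiegel W, C.rep c]`** (the `hrep` input of ★ `UnitaryCurve.continuous_of_pts_shadow`, FILE D §2 pattern): the
complex points of `𝓜.M ⊗ ℂ` are the points of the pieces `Sc c` (★ `Motives.exists_sigmaHomeomorph_of_isColimit_cofan` on `C.isColimit_ιc`), every point of a
piece is a `unif c W` (`C.unif_surj`), and `C.pts (ιc c (unif c W)) = [jOfSiegel W, rep c]` (`C.pts_unif`), `C.pts` a bijection.
[cite: Milne2005ShimuraVarieties, Thm. 6.11 p. 74 and (63) p. 116] [cite: Deligne1971TravauxShimura, 4.11–4.12 pp. 148–149] -/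
theorem AuxChartGS.exists_rep_of_siegelShimuraSet (x : SiegelShimuraSet C.δ (principalLevelSubgroup C.δ C.N)) :
    ∃ (c : (ZMod C.N)ˣ) (W : Matrix (Fin C.g) (Fin C.g) ℂ) (hW : W ∈ siegelUpperHalfSpace C.g),
      x = SiegelShimuraSet.mk C.δ (principalLevelSubgroup C.δ C.N) ⟨jOfSiegel C.δ W, C0_subset_C0pm C.δ (jOfSiegel_mem_C0 C.hδ.1 hW)⟩ (C.rep c) := by
  obtain ⟨hc⟩ := C.isColimit_ιc
  obtain ⟨Φc, hΦc⟩ := Literature.AlgebraicGeometry.Motives.exists_sigmaHomeomorph_of_isColimit_cofan ℂ hc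
  obtain ⟨⟨c, P⟩, hcP⟩ := Φc.surjective (C.pts.symm x)
  obtain ⟨W, hW, hWP⟩ := C.unif_surj c (Set.mem_univ P)
  refine ⟨c, W, hW, ?_⟩
  rw [← C.pts_unif c W hW, hWP, ← hΦc c P, hcP, Equiv.apply_symm_apply]

/-! ### §2 A map on `Sh_{Kc}(ℂ)` with Siegel shadow `[C.J v, x a]` is continuous -/

/-- **PER ADELIC `a`: `v ↦ G [v, aKc]` IS CONTINUOUS ON THE CONE** for any `G` with `C.pts (G [v, aKc]) = [C.J v, x a]` — ★ `UnitaryCurve.continuous_mk_left_of_pts_shadow`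
at the chart fields (`C.hJneg`, `C.hZ`, `C.unif_cont`, `C.pts_unif`, §1).  THE SHAPE ★ p850424 `ShimuraSetGS.eq_of_forall_mk_eq_of_forall_continuous_mk` consumes.
[cite: Deligne1979ShimuraVarieties, 2.1.2 and Prop. 2.3.10] [cite: Milne2005ShimuraVarieties, Lemma 5.13 p. 57, Thm. 6.11 p. 74] -/
theorem AuxChartGS.continuous_mk_left_of_pts_shadow (x : GSAdele F Jstar → ↥(gspFinAdelic C.δ))
    (G : ShimuraSetGS F Jstar ι₁ Kc.1.1 → ComplexPoints ((Literature.AlgebraicGeometry.Motives.baseChange ℚ ℂ).obj C.𝓜.M))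
    (hG : ∀ (v : Fin 2 → ℂ) (hv : v ∈ negCone (Jstar.map ι₁)) (a : GSAdele F Jstar),
      C.pts (G (ShimuraSetGS.mk F Jstar ι₁ Kc.1.1 v hv a)) = SiegelShimuraSet.mk C.δ (principalLevelSubgroup C.δ C.N) ⟨C.J v, C.hJ v hv⟩ (x a))
    (a : GSAdele F Jstar) :
    Continuous fun w : ↥(negCone (Jstar.map ι₁)) => G (ShimuraSetGS.mk F Jstar ι₁ Kc.1.1 (w : Fin 2 → ℂ) w.2 a) :=
  UnitaryCurve.continuous_mk_left_of_pts_shadow C.J C.hJ C.hg C.hδ.1 C.hJneg C.hZ C.Sc C.unif C.unif_cont C.rep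
    C.exists_rep_of_siegelShimuraSet Kc.1.1 x C.ιc C.pts C.pts_unif G hG a

/-- **A MAP ON `Sh_{Kc}(ℂ)` WITH SIEGEL SHADOW `[C.J v, x a]` IS CONTINUOUS** (`Kc` is open) — ★ `UnitaryCurve.continuous_of_pts_shadow` at the chart fields.
USE: `x a := C.b a * ũ_V(1, z)`, `G := f₂` (road B′, DEAL #35). [cite: Milne2005ShimuraVarieties, Lemma 5.13 p. 57, Thm. 6.11 p. 74, Lemma 13.5 and Thm. 13.6 (proof) p. 118]
[cite: Deligne1979ShimuraVarieties, 2.1.2 and Prop. 2.3.10] -/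
theorem AuxChartGS.continuous_of_pts_shadow (x : GSAdele F Jstar → ↥(gspFinAdelic C.δ))
    (G : ShimuraSetGS F Jstar ι₁ Kc.1.1 → ComplexPoints ((Literature.AlgebraicGeometry.Motives.baseChange ℚ ℂ).obj C.𝓜.M))
    (hG : ∀ (v : Fin 2 → ℂ) (hv : v ∈ negCone (Jstar.map ι₁)) (a : GSAdele F Jstar),
      C.pts (G (ShimuraSetGS.mk F Jstar ι₁ Kc.1.1 v hv a)) = SiegelShimuraSet.mk C.δ (principalLevelSubgroup C.δ C.N) ⟨C.J v, C.hJ v hv⟩ (x a)) :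
    Continuous G :=
  UnitaryCurve.continuous_of_pts_shadow C.J C.hJ C.hg C.hδ.1 C.hJneg C.hZ C.Sc C.unif C.unif_cont C.rep
    C.exists_rep_of_siegelShimuraSet Kc.1.1 x C.ιc C.pts C.pts_unif Kc.1.2.1 G hG

/-- **The same in the `ℚ`-points currency** (`G : Sh_{Kc}(ℂ) → 𝓜.M(ℂ)`, shadow through `AlgPoints.baseChangeEquiv (ℚ → ℂ) 𝓜.M` as in `C.f_pts`).
[cite: Milne2005ShimuraVarieties, Lemma 5.13 p. 57, Thm. 6.11 p. 74] [cite: ConradAdelicPoints2012, Prop. 2.1 and Prop. 3.1] -/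
theorem AuxChartGS.continuous_of_bce_pts_shadow (x : GSAdele F Jstar → ↥(gspFinAdelic C.δ))
    (G : ShimuraSetGS F Jstar ι₁ Kc.1.1 → ComplexPoints C.𝓜.M)
    (hG : ∀ (v : Fin 2 → ℂ) (hv : v ∈ negCone (Jstar.map ι₁)) (a : GSAdele F Jstar),
      C.pts (AlgPoints.baseChangeEquiv (algebraMap ℚ ℂ) C.𝓜.M (G (ShimuraSetGS.mk F Jstar ι₁ Kc.1.1 v hv a))) =
        SiegelShimuraSet.mk C.δ (principalLevelSubgroup C.δ C.N) ⟨C.J v, C.hJ v hv⟩ (x a)) :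
    Continuous G :=
  UnitaryCurve.continuous_of_bce_pts_shadow C.J C.hJ C.hg C.hδ.1 C.hJneg C.hZ C.Sc C.unif C.unif_cont C.rep
    C.exists_rep_of_siegelShimuraSet Kc.1.1 x C.ιc C.pts C.pts_unif Kc.1.2.1 G hG

/-! ### §3 The chart՚s own point map `C.f` is continuous (`x := C.b`, shadow `C.f_pts`) -/

/-- **PER ADELIC `a`: `v ↦ bce (C.f [v, aKc])` is continuous on the cone** (shadow `C.f_pts`). [cite: Deligne1979ShimuraVarieties, 2.1.2 and Prop. 2.3.10]
[cite: Milne2005ShimuraVarieties, Lemma 5.13 p. 57] -/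
theorem AuxChartGS.continuous_f_mk_left (a : GSAdele F Jstar) :
    Continuous fun w : ↥(negCone (Jstar.map ι₁)) =>
      AlgPoints.baseChangeEquiv (algebraMap ℚ ℂ) C.𝓜.M (C.f (ShimuraSetGS.mk F Jstar ι₁ Kc.1.1 (w : Fin 2 → ℂ) w.2 a)) :=
  C.continuous_mk_left_of_pts_shadow C.b (fun P => AlgPoints.baseChangeEquiv (algebraMap ℚ ℂ) C.𝓜.M (C.f P)) C.f_pts a

/-- **THE CHART՚S POINT MAP `C.f : Sh_{Kc}(ℂ) → 𝓜.M(ℂ)` IS CONTINUOUS** — the named export the E-line never stated (★ E4 derived it inside the Borel argument);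
`x := C.b`, shadow `C.f_pts`. [cite: Deligne1979ShimuraVarieties, 2.1.2 and Prop. 2.3.10] [cite: Milne2005ShimuraVarieties, Lemma 5.13 p. 57, Thm. 6.11 p. 74] -/
theorem AuxChartGS.continuous_f : Continuous C.f :=
  C.continuous_of_bce_pts_shadow C.b C.f C.f_pts


/-! ### §4 (ED. 2, add-only; DEAL #37a-CHART) THE TWISTED POINT MAP `f₂` AT THE CHART: `[v, aKc] ↦ bce⁻¹ (pts⁻¹ [C.J v, C.b a · ũ_V(1, t)])`, its shadow and its continuity -/

section TwistedPointMap

open Literature.AlgebraicGeometry.ShimuraVarieties.UnitaryCanonicalModel.Aux (torusFinAdelic)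
open Literature.AlgebraicGeometry.ShimuraVarieties.UnitaryCurve Literature.AlgebraicGeometry.ShimuraVarieties.UnitaryCurve.AuxV
open Summit.HodgeConjecture.HodgeConjecture.Cruxes.HLiu418.F0P6aChartFramePin (IsChartOfFrame)

variable (hΦ : IsCMTypeThrough ι₁ Φ) (ξ : F) (k : ℕ) (Fr : SymplecticFrameV F (RingHom.id F) Jstar ((k : ℚ) • ξ) C.g C.δ)

/-- **THE TORUS LEG COMMUTES WITH THE CHART՚S HODGE EMBEDDING**: under the frame pin `C.b = ũ_V ∘ inl`, `C.b a · ũ_V(1, t) = ũ_V(1, t) · C.b a` for every `a` — `ũ_V` is a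
homomorphism on the PRODUCT group `U(J⋆)(𝔸_f) × T(𝔸_f)` and `(a, 1)(1, t) = (a, t) = (1, t)(a, 1)` (the `hu` input of ★ `UnitaryCurve.exists_pointMap_of_shadow_mul`).
[cite: RapoportSmithlingZhang2020Diagonal, §3.2 pp. 11–14] [cite: Shimura1998, §18.6 (pp. 124–128)] -/
theorem AuxChartGS.b_mul_torusLeg_comm (hpin : IsChartOfFrame hΦ C ξ k Fr) (t : ↥(torusFinAdelic F)) (a : GSAdele F Jstar) :
    C.b a * auxToGspFinV Fr (1, t) = auxToGspFinV Fr (1, t) * C.b a := by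
  rw [hpin.2.1]
  simp only [MonoidHom.comp_apply, MonoidHom.inl_apply, ← map_mul, Prod.mk_mul_mk, one_mul, mul_one]

/-- **THE TWISTED POINT MAP `f₂` OF ROAD B′ AT THE CHART** (DEAL #37a): for a pinned chart `C` and any `t ∈ T(𝔸_f)` (the junction՚s reflex-norm idèle) there is
`f₂ : Sh_{Kc}(ℂ) → 𝓜.M(ℂ)` with SHADOW `C.pts (bce (f₂ [v, aKc])) = [C.J v, C.b a · ũ_V(1, t)]` (★ `UnitaryCurve.exists_pointMap_of_shadow_mul` + `b_mul_torusLeg_comm`), which is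
CONTINUOUS (★ p850443 ∕ `continuous_of_bce_pts_shadow`) and hence continuous in the cone variable on every piece (★ `ShimuraSetGS.continuous_mk_left`) — the `f₂`, `hf₂`
(shadow) and `hf₂c` (piecewise continuity) binders of ★ p850504 `thickeningLift_comp_slice_fst_eq_of_forward_recip_of_continuous` ∕ ★ p850527 `thickeningLift_comp_slice_fst_eq_fTwo`
and of ★ p849999 `exists_forward_law_of_correspondent_algEquiv` (its `f₂` shadow hypothesis, VERBATIM). [cite: Milne2005ShimuraVarieties, Lemma 5.13 p. 57, Thm. 13.6 p. 118]
[cite: Shimura1998, §18.6 (pp. 124–128)] [cite: Deligne1971TravauxShimura, Prop. 1.15 p. 132] -/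
theorem AuxChartGS.exists_fTwo (hpin : IsChartOfFrame hΦ C ξ k Fr) (t : ↥(torusFinAdelic F)) :
    ∃ f₂ : ShimuraSetGS F Jstar ι₁ Kc.1.1 → ComplexPoints C.𝓜.M,
      (∀ (v : Fin 2 → ℂ) (hv : v ∈ negCone (Jstar.map ι₁)) (a : GSAdele F Jstar),
        C.pts (AlgPoints.baseChangeEquiv (algebraMap ℚ ℂ) C.𝓜.M (f₂ (ShimuraSetGS.mk F Jstar ι₁ Kc.1.1 v hv a))) =
          SiegelShimuraSet.mk C.δ (principalLevelSubgroup C.δ C.N) ⟨C.J v, C.hJ v hv⟩ (C.b a * auxToGspFinV Fr (1, t))) ∧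
      Continuous f₂ ∧
      ∀ a : GSAdele F Jstar,
        Continuous fun w : ↥(negCone (Jstar.map ι₁)) => f₂ (ShimuraSetGS.mk F Jstar ι₁ Kc.1.1 (w : Fin 2 → ℂ) w.2 a) := by
  obtain ⟨f₂, hf₂⟩ := UnitaryCurve.exists_pointMap_of_shadow_mul C.J C.hJ C.b C.bq C.hJsmul C.hb C.hJrat Kc.1.1 C.hle
    (auxToGspFinV Fr (1, t)) (fun a _ => C.b_mul_torusLeg_comm hΦ ξ k Fr hpin t a) C.𝓜.M C.pts
  have hc : Continuous f₂ := C.continuous_of_bce_pts_shadow (fun a => C.b a * auxToGspFinV Fr (1, t)) f₂ hf₂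
  exact ⟨f₂, hf₂, hc, fun a => hc.comp (ShimuraSetGS.continuous_mk_left F Jstar ι₁ Kc.1.1 a)⟩

end TwistedPointMap

end Summit.HodgeConjecture.HodgeConjecture.Cruxes.HLiu418.F0P6aPELWitnessE

end
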